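import Summits.Ventures.YMGap.Census.DecimationTwist
import Summits.Ventures.YMGap.Census.DecimationInterpolated
import Summits.Ventures.YMGap.Census.ZplusMonotone
import HarnessLib

/-!
# Venture YMGap, track (b) census — Tomboulis's Prop. IV.3 (4.12) at `r = 1` on the positivity domain

HONEST FRAMING: venture file of the cell `pub-ymgap` (QuantumFields programme), track (b) census.  Exact statement about the finite
tori `(ℤ/bLℤ)^d → (ℤ/Lℤ)^d` (`L ≥ 2`); nothing about (5.15), confinement or any limit.

Tomboulis (arXiv:0707.2179, App. A §4, last lines): "Combining (UAtwist) with (UA) … then gives IV.3" — at `r = 1` the `Z⁺ = (Z + Z⁻)/2`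
bound (4.12) is the average of `decimationUpperBound_of_nonneg` (III.1, (A.19)) and `twistedDecimationUpperBound_of_nonneg` (UAtwist),
which share the bulk factor `F₀^U(1)^{|Λ^{(1)}|}` and the decimated coefficients `c^U_j(1,1)`.  KERNEL:
`decimationUpperBoundPlus_of_nonneg : Z⁺_{(ℤ/bL)^d}({c_j}; 𝒱_{ij}) ≤ F₀^U(1)^{|Λ^{(1)}|} · Z⁺_{(ℤ/L)^d}({c^U_j(1,1)}; 𝒱_{ij})` for every
`d`, `b ≥ 1`, `L ≥ 2`, `J`, `i < j`, admissible `c` with `f_c ≥ 0`; and, as printed ("Combining (UAtwist) with (UA) and IV.2(i),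
(upperc1)"), for every `0 < r ≤ 1` on EVEN coarse tori via the tree's IV.2 (i) (`torusZplus_mono`) and `ĉ_j^{b²} ≤ ĉ_j^{b²r}`
(`mkCoeff_one_le_mkCoeff`): `decimationUpperBoundPlus_of_nonneg_of_le_one`. [cite: Tomboulis2007Confinement, Prop. IV.3 eq. (4.12); App. A §4]
-/

noncomputable section

open MeasureTheory Finset Real
open scoped BigOperators
open Literature.MathematicalPhysics.QuantumLattice
open Literature.MathematicalPhysics.QuantumFieldTheory
open Literature.MathematicalPhysics.QuantumFieldTheory.Tomboulis2007

namespace Summit.Ventures.YMGap.Census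

variable {d L : ℕ} {b : ℕ} [NeZero b] [NeZero L]

/-- **Tomboulis's Prop. IV.3 (arXiv:0707.2179 (4.12)) at `r = 1` on the positivity domain**:
`Z⁺_{(ℤ/bL)^d}({c_j}) ≤ F₀^U(1)^{|Λ^{(1)}|} · Z⁺_{(ℤ/L)^d}({c^U_j(1,1)})`, `Z⁺ = (Z + Z⁻)/2` with the twist on `𝒱_{ij}` on both tori,
for every `d`, `b ≥ 1`, `L ≥ 2`, cut-off `J`, plane `i < j`, and admissible `c` with `f_c ≥ 0`. -/
theorem decimationUpperBoundPlus_of_nonneg [Fact (1 < L)] {i j : Fin d} (hij : i < j) (J : ℕ) {c : ℕ → ℝ}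
    (hc : CoeffAdmissible c) (hf : ∀ g : SU2, 0 ≤ plaqFn J c g) :
    torusZplus d (b * L) J c (vortexSheet (b * L) i j hij) ≤
      mkF0 J c (b ^ (d - 2)) b ^ Fintype.card (Plaquette d L) *
        torusZplus d L (b ^ (d - 2) * J) (mkCoeff J c (b ^ (d - 2)) b 1) (vortexSheet L i j hij) := by
  have h1 := decimationUpperBound_of_nonneg (d := d) (L := L) (b := b) J hc hf
  have h2 := twistedDecimationUpperBound_of_nonneg (d := d) (L := L) (b := b) hij J hc hf
  unfold torusZplus
  rw [mul_div_assoc', mul_add]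
  linarith

/-- **Tomboulis's Prop. IV.3 (arXiv:0707.2179 (4.12)) for every `0 < r ≤ 1` on the positivity domain, even coarse torus**:
`Z⁺_{(ℤ/bL)^d}({c_j}) ≤ F₀^U(1)^{|Λ^{(1)}|} · Z⁺_{(ℤ/L)^d}({c^U_j(1,r)})` (`ζ = b^{d-2}`, `L ≥ 2` even, every `d`, `b ≥ 1`, `J`, `i < j`),
from the `r = 1` case and IV.2 (i) (`torusZplus_mono`), since `c^U_j(1,1) = ĉ_j^{b²} ≤ ĉ_j^{b²r} = c^U_j(1,r)` on `ĉ_j ∈ [0,1]`. -/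
theorem decimationUpperBoundPlus_of_nonneg_of_le_one (hL : Even L) {i j : Fin d} (hij : i < j) (J : ℕ) {c : ℕ → ℝ}
    (hc : CoeffAdmissible c) (hf : ∀ g : SU2, 0 ≤ plaqFn J c g) {r : ℝ} (hr0 : 0 ≤ r) (hr1 : r ≤ 1) :
    torusZplus d (b * L) J c (vortexSheet (b * L) i j hij) ≤
      mkF0 J c (b ^ (d - 2)) b ^ Fintype.card (Plaquette d L) *
        torusZplus d L (b ^ (d - 2) * J) (mkCoeff J c (b ^ (d - 2)) b r) (vortexSheet L i j hij) := by
  have hc' : ∀ n, 1 ≤ n → 0 ≤ c n := fun n hn => (hc n hn).1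
  haveI : Fact (1 < L) := ⟨by obtain ⟨k, hk⟩ := hL; have := NeZero.ne L; omega⟩
  refine (decimationUpperBoundPlus_of_nonneg hij J hc hf).trans (mul_le_mul_of_nonneg_left ?_ ?_)
  · exact torusZplus_mono hL _ hij (coeffAdmissible_mkCoeff_one_of_nonneg hc' hf _ b)
      (coeffAdmissible_mkCoeff_of_nonneg J hc' hf _ hr0) (mkCoeff_one_le_mkCoeff J hc' hf _ hr0 hr1)
  · exact pow_nonneg (zero_le_one.trans (one_le_mkF0 hc' _ b)) _

end Summit.Ventures.YMGap.Census

end
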